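import Literature.AlgebraicGeometry.Motives.MixedHodgeExtensionNonSeparatedGroup
import Literature.AlgebraicGeometry.Motives.MixedHodgeExtensionExactSequences
import HarnessLib

/-!
# Extensions of arbitrary mixed Hodge structures, VI: the six-term sequences and right exactness

Brylinski–Zucker, *An overview of recent advances in Hodge theory*, Prop. 5.22 (after Morgan and
Beilinson): `Ext¹_{A-MH}(E, F) ≅ Hom^W(E_ℂ, F_ℂ)/(Hom^W_F + Hom^W(E, F))` and, "as a corollary,
`Ext^j_{A-MH}(E, F) = 0` for `j ≥ 2`". The tree's six-term sequences
(`MixedHodgeExtensionExactSequences.lean`, Mac Lane III Thms. 3.2, 3.4) are proved at the level of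
split extensions and, in Carlson's classes, only for separated pairs; "`Ext²` and the failure of
right exactness are not treated". With Brylinski–Zucker's complete invariant `clsW` and the group
`Ext(A, B)` of ALL pairs (`MixedHodgeExtensionNonSeparatedGroup.lean`) this file proves:

* §1 **Right exactness — the shadow of `Ext² = 0`.** For a SURJECTIVE morphism `g : B → B'`,
  `g_* : J⁰W₀Hom(A, B) → J⁰W₀Hom(A, B')` and `g_* : Ext(A, B) → Ext(A, B')` are surjective; for an
  INJECTIVE `f : A' → A`, `f^* : Ext(A, B) → Ext(A', B)` is surjective (lift along a BIGRADED section /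
  retraction of `g_ℂ` / `f_ℂ`, Deligne's splitting, `MixedHodgeStructureBigradedSections.lean`). So
  for an extension `0 → B → E → A → 0` the sequences of Mac Lane III Thm. 3.4 / Thm. 3.2 END with
  `Ext(K, E) —π_*→ Ext(K, A) → 0` and `Ext(E, K) —i^*→ Ext(B, K) → 0`: every extension of `K` by `A`
  is `π_*` of an extension of `K` by `E`, every extension of `B` by `K` is `i^*` of one of `E` by `K`.
* §2 **The six-term sequences in `Ext` for arbitrary pairs** (no `IsSeparated`): exactness at
  `Ext(K, B)` (`pushoutMapW_inc_eq_zeroW_iff`), at `Ext(K, E)` (`pushoutMapW_proj_eq_zeroW_iff`),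
  at `Ext(A, K)` (`pullbackMapW_proj_eq_zeroW_iff`), at `Ext(E, K)` (`pullbackMapW_inc_eq_zeroW_iff`),
  together with the class forms in `J⁰W₀Hom`.

All statements proved; no named facts.

## References

* [BrylinskiZucker1998] J.-L. Brylinski, S. Zucker, An overview of recent advances in Hodge theory,
  Prop. 5.22 and its corollary `Ext^j = 0`, `j ≥ 2`.
* [MacLane1963Homology] S. Mac Lane, Homology (1963), Ch. III Thm. 3.2, Thm. 3.4.
* [Carlson1980] J. A. Carlson, Extensions of mixed Hodge structures (1980), §2(b) Prop. 1.
* [CattaniElZeinGriffithsLe2014] E. Cattani, F. El Zein, P. A. Griffiths, Lê D. T., Hodge theory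
  (2014), Prop. 3.2.19 (morphisms are bigraded for Deligne's `I^{p,q}`).
-/

open scoped TensorProduct

noncomputable section

namespace Literature.AlgebraicGeometry.Motives

namespace MixedHodgeStructure

universe u v w u' v' w'

variable {VA : Type u} [AddCommGroup VA] [Module ℚ VA]
variable {VB : Type v} [AddCommGroup VB] [Module ℚ VB]
variable {VE : Type w} [AddCommGroup VE] [Module ℚ VE]
variable {VA' : Type u'} [AddCommGroup VA'] [Module ℚ VA']
variable {VB' : Type v'} [AddCommGroup VB'] [Module ℚ VB']
variable {VK : Type w'} [AddCommGroup VK] [Module ℚ VK]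

/-! ### §1 Right exactness: `g_*` along surjections and `f^*` along injections are onto -/

section RightExact

variable {A : MixedHodgeStructure VA} {B : MixedHodgeStructure VB}
variable {A' : MixedHodgeStructure VA'} {B' : MixedHodgeStructure VB'}

/-- A bigraded `ℂ`-linear map composed with a weight-preserving one is weight-preserving.
[cite: CattaniElZeinGriffithsLe2014, Prop. 3.2.19] -/
theorem comp_mem_homW_of_isBigraded {s : ℂ ⊗[ℚ] VB' →ₗ[ℂ] ℂ ⊗[ℚ] VB} (hs : IsBigraded B' B s)
    {φ : ℂ ⊗[ℚ] VA →ₗ[ℂ] ℂ ⊗[ℚ] VB'} (hφ : φ ∈ homW A B') : s ∘ₗ φ ∈ homW A B := fun k => by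
  rw [Submodule.map_comp]
  exact (Submodule.map_mono (hφ k)).trans (hs.map_baseChange_W_le k)

/-- A weight-preserving map composed with a bigraded `ℂ`-linear one is weight-preserving.
[cite: CattaniElZeinGriffithsLe2014, Prop. 3.2.19] -/
theorem mem_homW_comp_of_isBigraded {r : ℂ ⊗[ℚ] VA →ₗ[ℂ] ℂ ⊗[ℚ] VA'} (hr : IsBigraded A A' r)
    {φ : ℂ ⊗[ℚ] VA' →ₗ[ℂ] ℂ ⊗[ℚ] VB} (hφ : φ ∈ homW A' B) : φ ∘ₗ r ∈ homW A B := fun k => by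
  rw [Submodule.map_comp]
  exact (Submodule.map_mono (hr.map_baseChange_W_le k)).trans (hφ k)

/-- **`g_* : J⁰W₀Hom(A, B) → J⁰W₀Hom(A, B')` is surjective for a surjective morphism `g : B → B'`**:
lift `[φ']` to `[s ∘ φ']` with `s` a bigraded section of `g_ℂ` (Deligne's splitting is functorial, so
`g_ℂ` is surjective on each `I^{p,q}`). Under `Ext ≅ J⁰W₀Hom` this is the vanishing of the
`Ext²`-obstruction (Brylinski–Zucker, corollary to Prop. 5.22). [cite: BrylinskiZucker1998, Prop. 5.22] -/
theorem JHomW.postcomp_surjective_of_surjective (g : Hom B B') (hg : Function.Surjective g.toLinearMap) :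
    Function.Surjective (JHomW.postcomp A g) := by
  intro y
  obtain ⟨φ', rfl⟩ := JHomW.mk_surjective y
  obtain ⟨s, hs, hbi⟩ := g.exists_isBigraded_section hg
  refine ⟨JHomW.mk A B ⟨s ∘ₗ φ', comp_mem_homW_of_isBigraded hbi φ'.2⟩, ?_⟩
  rw [JHomW.postcomp_mk]
  congr 1
  apply Subtype.ext
  change g.toLinearMap.baseChange ℂ ∘ₗ (s ∘ₗ (φ' : ℂ ⊗[ℚ] VA →ₗ[ℂ] ℂ ⊗[ℚ] VB')) = φ'
  rw [← LinearMap.comp_assoc, hs, LinearMap.id_comp]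

/-- **`f^* : J⁰W₀Hom(A, B) → J⁰W₀Hom(A', B)` is surjective for an injective morphism `f : A' → A`**:
lift `[φ']` to `[φ' ∘ r]` with `r` a bigraded retraction of `f_ℂ`. [cite: BrylinskiZucker1998, Prop. 5.22] -/
theorem JHomW.precomp_surjective_of_injective (f : Hom A' A) (hf : Function.Injective f.toLinearMap) :
    Function.Surjective (JHomW.precomp B f) := by
  intro y
  obtain ⟨φ', rfl⟩ := JHomW.mk_surjective y
  obtain ⟨r, hr, hbi⟩ := f.exists_isBigraded_retraction hf
  refine ⟨JHomW.mk A B ⟨φ' ∘ₗ r, mem_homW_comp_of_isBigraded hbi φ'.2⟩, ?_⟩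
  rw [JHomW.precomp_mk]
  congr 1
  apply Subtype.ext
  change ((φ' : ℂ ⊗[ℚ] VA' →ₗ[ℂ] ℂ ⊗[ℚ] VB) ∘ₗ r) ∘ₗ f.toLinearMap.baseChange ℂ = φ'
  rw [LinearMap.comp_assoc, hr, LinearMap.comp_id]

namespace Ext

/-- **`g_* : Ext(A, B) → Ext(A, B')` is surjective for surjective `g : B ↠ B'`** — the functor
`Ext(A, ·)` is right exact on mixed Hodge structures (Brylinski–Zucker: `Ext² = 0`), for ALL `A`,
`B`, `B'`. [cite: BrylinskiZucker1998, Prop. 5.22] -/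
theorem pushoutMapW_surjective_of_surjective (g : Hom B B') (hg : Function.Surjective g.toLinearMap) :
    Function.Surjective (pushoutMapW g : Ext A B → Ext A B') :=
  extEquivJHomW.symm.surjective.comp
    ((JHomW.postcomp_surjective_of_surjective g hg).comp (clsW_bijective (A := A) (B := B)).2)

/-- **`f^* : Ext(A, B) → Ext(A', B)` is surjective for injective `f : A' ↪ A`** — `Ext(·, B)` takes
injections to surjections (Brylinski–Zucker: `Ext² = 0`), for ALL `A`, `A'`, `B`.
[cite: BrylinskiZucker1998, Prop. 5.22] -/
theorem pullbackMapW_surjective_of_injective (f : Hom A' A) (hf : Function.Injective f.toLinearMap) :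
    Function.Surjective (pullbackMapW f : Ext A B → Ext A' B) :=
  extEquivJHomW.symm.surjective.comp
    ((JHomW.precomp_surjective_of_injective f hf).comp (clsW_bijective (A := A) (B := B)).2)

end Ext

namespace Extension

/-- **Every extension of `A` by a quotient `B'` of `B` lifts**: for surjective `g : B ↠ B'` and any
extension `E'` of `A` by `B'` there is an extension `E` of `A` by `B` with `g_* E ≡ E'`.
[cite: BrylinskiZucker1998, Prop. 5.22] -/
theorem exists_congruence_pushout_of_surjective (g : Hom B B') (hg : Function.Surjective g.toLinearMap)
    {VE' : Type*} [AddCommGroup VE'] [Module ℚ VE'] (E' : Extension A B' VE') :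
    ∃ E : Extension A B (VA × VB), Nonempty (Congruence (E.pushout g) E') := by
  obtain ⟨x, hx⟩ := Ext.pushoutMapW_surjective_of_surjective g hg (Ext.mkOfW E')
  obtain ⟨E, rfl⟩ := Ext.mk_surjective x
  refine ⟨E, (Ext.mkOfW_eq_mkOfW_iff _ _).1 ?_⟩
  rw [← Ext.pushoutMapW_mkOfW, Ext.mkOfW_eq_mk, hx]

/-- **Every extension of a sub-MHS `A'` of `A` by `B` extends**: for injective `f : A' ↪ A` and any
extension `E'` of `A'` by `B` there is an extension `E` of `A` by `B` with `f^* E ≡ E'`.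
[cite: BrylinskiZucker1998, Prop. 5.22] -/
theorem exists_congruence_pullback_of_injective (f : Hom A' A) (hf : Function.Injective f.toLinearMap)
    {VE' : Type*} [AddCommGroup VE'] [Module ℚ VE'] (E' : Extension A' B VE') :
    ∃ E : Extension A B (VA × VB), Nonempty (Congruence (E.pullback f) E') := by
  obtain ⟨x, hx⟩ := Ext.pullbackMapW_surjective_of_injective f hf (Ext.mkOfW E')
  obtain ⟨E, rfl⟩ := Ext.mk_surjective x
  refine ⟨E, (Ext.mkOfW_eq_mkOfW_iff _ _).1 ?_⟩
  rw [← Ext.pullbackMapW_mkOfW, Ext.mkOfW_eq_mk, hx]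

end Extension

end RightExact

/-! ### §2 The six-term sequences for arbitrary pairs -/

namespace Extension

variable {A : MixedHodgeStructure VA} {B : MixedHodgeStructure VB} {K : MixedHodgeStructure VK}
variable (E : Extension A B VE)

/-- `i_* [E]_W = 0` (`i_* E` splits). [cite: MacLane1963Homology, Ch. III Prop. 1.7] -/
theorem postcomp_inc_clsW : JHomW.postcomp A E.inc E.clsW = 0 := by
  rw [← clsW_pushout]
  exact clsW_eq_zero_of_isSplit E.isSplit_pushout_inc

/-- `π^* [E]_W = 0` (`π^* E` splits). [cite: MacLane1963Homology, Ch. III Prop. 1.7] -/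
theorem precomp_proj_clsW : JHomW.precomp B E.proj E.clsW = 0 := by
  rw [← clsW_pullback]
  exact clsW_eq_zero_of_isSplit E.isSplit_pullback_proj

/-- **Thm. 3.4, right end: `π_* : Ext(K, E) → Ext(K, A)` is onto** (every extension of `K` by `A`
is `π_*` of an extension of `K` by `E`; `Ext²(K, B) = 0`). [cite: BrylinskiZucker1998, Prop. 5.22] -/
theorem pushoutMapW_proj_surjective :
    Function.Surjective (Ext.pushoutMapW E.proj : Ext K E.mhs → Ext K A) :=
  Ext.pushoutMapW_surjective_of_surjective E.proj E.surjective_proj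

/-- **Thm. 3.2, right end: `i^* : Ext(E, K) → Ext(B, K)` is onto** (every extension of `B` by `K`
is `i^*` of an extension of `E` by `K`; `Ext²(A, K) = 0`). [cite: BrylinskiZucker1998, Prop. 5.22] -/
theorem pullbackMapW_inc_surjective :
    Function.Surjective (Ext.pullbackMapW E.inc : Ext E.mhs K → Ext B K) :=
  Ext.pullbackMapW_surjective_of_injective E.inc E.injective_inc

/-- **Thm. 3.4 at `Ext(K, B)` in `J⁰W₀Hom`, all pairs**: `i_* [F]_W = 0` iff `[F]_W = f^* [E]_W` for
some morphism `f : K → A` (the tree's `postcomp_inc_cls_eq_zero_iff` needs `K`, `E` separated).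
[cite: MacLane1963Homology, Ch. III Thm. 3.4] -/
theorem postcomp_inc_clsW_eq_zero_iff {VF : Type*} [AddCommGroup VF] [Module ℚ VF]
    (F : Extension K B VF) :
    JHomW.postcomp K E.inc F.clsW = 0 ↔ ∃ f : Hom K A, F.clsW = JHomW.precomp B f E.clsW := by
  constructor
  · intro h
    rw [← clsW_pushout, ← isSplit_iff_clsW_eq_zero] at h
    obtain ⟨m, hm⟩ := (E.isSplit_pushout_inc_iff_exists_morphism F).1 h
    exact ⟨m.right, m.clsW_eq_precomp_clsW hm⟩
  · rintro ⟨f, hf⟩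
    rw [hf, ← LinearMap.comp_apply, ← JHomW.precomp_comp_postcomp, LinearMap.comp_apply,
      postcomp_inc_clsW, map_zero]

/-- **Thm. 3.2 at `Ext(A, K)` in `J⁰W₀Hom`, all pairs**: `π^* [G]_W = 0` iff `[G]_W = g_* [E]_W` for
some morphism `g : B → K`. [cite: MacLane1963Homology, Ch. III Thm. 3.2] -/
theorem precomp_proj_clsW_eq_zero_iff {VG : Type*} [AddCommGroup VG] [Module ℚ VG]
    (G : Extension A K VG) :
    JHomW.precomp K E.proj G.clsW = 0 ↔ ∃ g : Hom B K, G.clsW = JHomW.postcomp A g E.clsW := by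
  constructor
  · intro h
    rw [← clsW_pullback, ← isSplit_iff_clsW_eq_zero] at h
    obtain ⟨m, hm⟩ := (E.isSplit_pullback_proj_iff_exists_morphism G).1 h
    exact ⟨m.left, m.clsW_eq_postcomp_clsW hm⟩
  · rintro ⟨g, hg⟩
    rw [hg, ← LinearMap.comp_apply, JHomW.precomp_comp_postcomp, LinearMap.comp_apply,
      precomp_proj_clsW, map_zero]

section Middle

variable {VG : Type*} [AddCommGroup VG] [Module ℚ VG]

/-- `[G]_W = i_* [ker r]_W` for an extension `G` of `K` by `E` over which `π` extends to `r`.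
[cite: MacLane1963Homology, Ch. III Thm. 3.4] -/
theorem clsW_eq_postcomp_inc_clsW_kerExtension (G : Extension K E.mhs VG) (r : Hom G.mhs A)
    (hr : r.comp G.inc = E.proj) :
    G.clsW = JHomW.postcomp K E.inc (E.kerExtension G r hr).clsW := by
  rw [← clsW_pushout]
  exact (clsW_eq_of_congruence (E.congruenceKerExtensionPushout G r hr)).symm

/-- **Thm. 3.4 at `Ext(K, E)` in `J⁰W₀Hom`, all pairs**: `π_* [G]_W = 0` iff `[G]_W = i_* [F]_W` for
the extension `F = ker r` of `K` by `B` (the tree's class form needs `K`, `A` separated).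
[cite: MacLane1963Homology, Ch. III Thm. 3.4] -/
theorem postcomp_proj_clsW_eq_zero_iff_exists_kerExtension (G : Extension K E.mhs VG) :
    JHomW.postcomp K E.proj G.clsW = 0 ↔
      ∃ (r : Hom G.mhs A) (hr : r.comp G.inc = E.proj),
        G.clsW = JHomW.postcomp K E.inc (E.kerExtension G r hr).clsW := by
  constructor
  · intro h
    rw [← clsW_pushout, ← isSplit_iff_clsW_eq_zero, isSplit_pushout_iff] at h
    obtain ⟨r, hr⟩ := h
    exact ⟨r, hr, E.clsW_eq_postcomp_inc_clsW_kerExtension G r hr⟩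
  · rintro ⟨r, hr, h⟩
    have h0 : E.proj.comp E.inc = Hom.zero B A := Hom.ext (LinearMap.ext fun b => E.proj_inc b)
    rw [h, ← LinearMap.comp_apply, ← JHomW.postcomp_comp, h0, ← clsW_pushout]
    exact clsW_eq_zero_of_isSplit (E.kerExtension G r hr).isSplit_pushout_zero

/-- `[G']_W = π^* [coker s]_W` for an extension `G'` of `E` by `K` through which `i` lifts to `s`.
[cite: MacLane1963Homology, Ch. III Thm. 3.2] -/
theorem clsW_eq_precomp_proj_clsW_cokerExtension (G' : Extension E.mhs K VG) (s : Hom B G'.mhs)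
    (hs : G'.proj.comp s = E.inc) :
    G'.clsW = JHomW.precomp K E.proj (E.cokerExtension G' s hs).clsW := by
  rw [← clsW_pullback]
  exact clsW_eq_of_congruence (E.congruencePullbackCokerExtension G' s hs)

/-- **Thm. 3.2 at `Ext(E, K)` in `J⁰W₀Hom`, all pairs**: `i^* [G']_W = 0` iff `[G']_W = π^* [G]_W`
for the extension `G = coker s` of `A` by `K`. [cite: MacLane1963Homology, Ch. III Thm. 3.2] -/
theorem precomp_inc_clsW_eq_zero_iff_exists_cokerExtension (G' : Extension E.mhs K VG) :
    JHomW.precomp K E.inc G'.clsW = 0 ↔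
      ∃ (s : Hom B G'.mhs) (hs : G'.proj.comp s = E.inc),
        G'.clsW = JHomW.precomp K E.proj (E.cokerExtension G' s hs).clsW := by
  constructor
  · intro h
    rw [← clsW_pullback, ← isSplit_iff_clsW_eq_zero, isSplit_pullback_iff] at h
    obtain ⟨s, hs⟩ := h
    exact ⟨s, hs, E.clsW_eq_precomp_proj_clsW_cokerExtension G' s hs⟩
  · rintro ⟨s, hs, h⟩
    have h0 : E.proj.comp E.inc = Hom.zero B A := Hom.ext (LinearMap.ext fun b => E.proj_inc b)
    rw [h, ← LinearMap.comp_apply, ← JHomW.precomp_comp, h0, ← clsW_pullback]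
    exact clsW_eq_zero_of_isSplit (E.cokerExtension G' s hs).isSplit_pullback_zero

end Middle

end Extension

/-! ### The six-term sequences in the group `Ext` (all pairs) -/

namespace Ext

open Extension

variable {A : MixedHodgeStructure VA} {B : MixedHodgeStructure VB} {K : MixedHodgeStructure VK}
variable (E : Extension A B VE)

/-- **Exactness of `Hom(K, A) —E_*→ Ext(K, B) —i_*→ Ext(K, E)`** (Mac Lane III Thm. 3.4) in the group
`Ext` of arbitrary pairs: `i_* x = 0 ↔ x = f^* [E]` for some `f : K → A`.
[cite: MacLane1963Homology, Ch. III Thm. 3.4] -/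
theorem pushoutMapW_inc_eq_zeroW_iff (x : Ext K B) :
    pushoutMapW E.inc x = zeroW ↔ ∃ f : Hom K A, x = pullbackMapW f (mkOfW E) := by
  constructor
  · intro h
    obtain ⟨F, rfl⟩ := mk_surjective x
    rw [← mkOfW_eq_mk, pushoutMapW_mkOfW, mkOfW_eq_zeroW_iff,
      E.isSplit_pushout_inc_iff_exists_morphism] at h
    obtain ⟨m, hm⟩ := h
    refine ⟨m.right, extEquivJHomW.injective ?_⟩
    rw [extEquivJHomW_mk, extEquivJHomW_pullbackMapW, clsW_mkOfW]
    exact m.clsW_eq_precomp_clsW hm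
  · rintro ⟨f, rfl⟩
    rw [pushoutMapW_pullbackMapW, pushoutMapW_mkOfW, (mkOfW_eq_zeroW_iff _).2 E.isSplit_pushout_inc,
      pullbackMapW_zeroW]

/-- **Exactness of `Ext(K, B) —i_*→ Ext(K, E) —π_*→ Ext(K, A)`** (Mac Lane III Thm. 3.4), all pairs:
`π_* y = 0 ↔ y = i_* x` for some `x ∈ Ext(K, B)`. [cite: MacLane1963Homology, Ch. III Thm. 3.4] -/
theorem pushoutMapW_proj_eq_zeroW_iff (y : Ext K E.mhs) :
    pushoutMapW E.proj y = zeroW ↔ ∃ x : Ext K B, y = pushoutMapW E.inc x := by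
  constructor
  · intro h
    obtain ⟨G, rfl⟩ := mk_surjective y
    rw [← mkOfW_eq_mk, pushoutMapW_mkOfW, mkOfW_eq_zeroW_iff] at h
    obtain ⟨r, hr, ⟨c⟩⟩ := E.exists_congruence_pushout_inc_of_isSplit_pushout_proj G h
    exact ⟨mkOfW (E.kerExtension G r hr), by
      rw [pushoutMapW_mkOfW, mkOfW_eq_of_congruence c, mkOfW_eq_mk]⟩
  · rintro ⟨x, rfl⟩
    obtain ⟨F, rfl⟩ := mk_surjective x
    rw [← mkOfW_eq_mk F, pushoutMapW_mkOfW, pushoutMapW_mkOfW, mkOfW_eq_zeroW_iff]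
    exact E.isSplit_pushout_inc_pushout_proj F

/-- **Exactness of `Hom(B, K) —E^*→ Ext(A, K) —π^*→ Ext(E, K)`** (Mac Lane III Thm. 3.2), all pairs:
`π^* y = 0 ↔ y = g_* [E]` for some `g : B → K`. [cite: MacLane1963Homology, Ch. III Thm. 3.2] -/
theorem pullbackMapW_proj_eq_zeroW_iff (y : Ext A K) :
    pullbackMapW E.proj y = zeroW ↔ ∃ g : Hom B K, y = pushoutMapW g (mkOfW E) := by
  constructor
  · intro h
    obtain ⟨G, rfl⟩ := mk_surjective y
    rw [← mkOfW_eq_mk, pullbackMapW_mkOfW, mkOfW_eq_zeroW_iff,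
      E.isSplit_pullback_proj_iff_exists_morphism] at h
    obtain ⟨m, hm⟩ := h
    refine ⟨m.left, extEquivJHomW.injective ?_⟩
    rw [extEquivJHomW_mk, extEquivJHomW_pushoutMapW, clsW_mkOfW]
    exact m.clsW_eq_postcomp_clsW hm
  · rintro ⟨g, rfl⟩
    rw [← pushoutMapW_pullbackMapW, pullbackMapW_mkOfW, (mkOfW_eq_zeroW_iff _).2 E.isSplit_pullback_proj,
      pushoutMapW_zeroW]

/-- **Exactness of `Ext(A, K) —π^*→ Ext(E, K) —i^*→ Ext(B, K)`** (Mac Lane III Thm. 3.2), all pairs: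
`i^* y = 0 ↔ y = π^* x` for some `x ∈ Ext(A, K)`. [cite: MacLane1963Homology, Ch. III Thm. 3.2] -/
theorem pullbackMapW_inc_eq_zeroW_iff (y : Ext E.mhs K) :
    pullbackMapW E.inc y = zeroW ↔ ∃ x : Ext A K, y = pullbackMapW E.proj x := by
  constructor
  · intro h
    obtain ⟨G', rfl⟩ := mk_surjective y
    rw [← mkOfW_eq_mk, pullbackMapW_mkOfW, mkOfW_eq_zeroW_iff] at h
    obtain ⟨s, hs, ⟨c⟩⟩ := E.exists_congruence_pullback_proj_of_isSplit_pullback_inc G' h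
    exact ⟨mkOfW (E.cokerExtension G' s hs), by
      rw [pullbackMapW_mkOfW, ← mkOfW_eq_of_congruence c, mkOfW_eq_mk]⟩
  · rintro ⟨x, rfl⟩
    obtain ⟨G, rfl⟩ := mk_surjective x
    rw [← mkOfW_eq_mk G, pullbackMapW_mkOfW, pullbackMapW_mkOfW, mkOfW_eq_zeroW_iff]
    exact E.isSplit_pullback_proj_pullback_inc G

/-- `i_* (f^* [E]) = 0` in `Ext(K, E)`. [cite: MacLane1963Homology, Ch. III Thm. 3.4] -/
theorem pushoutMapW_inc_pullbackMapW_mkOfW (f : Hom K A) :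
    pushoutMapW E.inc (pullbackMapW f (mkOfW E)) = zeroW :=
  (pushoutMapW_inc_eq_zeroW_iff E _).2 ⟨f, rfl⟩

/-- `π_* (i_* x) = 0` in `Ext(K, A)`. [cite: MacLane1963Homology, Ch. III Thm. 3.4] -/
theorem pushoutMapW_proj_pushoutMapW_inc (x : Ext K B) :
    pushoutMapW E.proj (pushoutMapW E.inc x) = zeroW :=
  (pushoutMapW_proj_eq_zeroW_iff E _).2 ⟨x, rfl⟩

/-- `π^* (g_* [E]) = 0` in `Ext(E, K)`. [cite: MacLane1963Homology, Ch. III Thm. 3.2] -/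
theorem pullbackMapW_proj_pushoutMapW_mkOfW (g : Hom B K) :
    pullbackMapW E.proj (pushoutMapW g (mkOfW E)) = zeroW :=
  (pullbackMapW_proj_eq_zeroW_iff E _).2 ⟨g, rfl⟩

/-- `i^* (π^* x) = 0` in `Ext(B, K)`. [cite: MacLane1963Homology, Ch. III Thm. 3.2] -/
theorem pullbackMapW_inc_pullbackMapW_proj (x : Ext A K) :
    pullbackMapW E.inc (pullbackMapW E.proj x) = zeroW :=
  (pullbackMapW_inc_eq_zeroW_iff E _).2 ⟨x, rfl⟩

end Ext

end MixedHodgeStructure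

end Literature.AlgebraicGeometry.Motives

end
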